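import Literature.Topology.FourManifolds.HomotopySpheresSignatureReduction
import Literature.Topology.FourManifolds.HCobordismWallDuality
import Literature.Topology.FourManifolds.NullCobordismBoundaryHomology
import Literature.AlgebraicTopology.SingularHomology.HurewiczVanishingProofs
import Literature.AlgebraicTopology.SingularHomology.NoncompactManifoldProofs
import Literature.AlgebraicTopology.SingularHomology.UniversalCoefficientsFree
import Literature.AlgebraicTopology.SingularHomology.ExcisionMayerVietorisProofs
import Literature.AlgebraicTopology.SingularHomology.FundamentalClassExistence
import Literature.AlgebraicTopology.Homotopy.CompactManifoldCWTypeProofs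
import Literature.AlgebraicTopology.Homotopy.WhiteheadContractibleLeaves
import HarnessLib

/-!
# Kervaire–Milnor's Theorem 6.6, last clause: a null-cobordism of a homotopy sphere which is
# connected up to half its dimension is contractible — and Theorem 7.5 from "`H₂ₘM` can be killed"

Topic `Literature/Topology/FourManifolds`; third sibling proofs file of
`HomotopySpheresSignature.lean` (after `HomotopySpheresSignatureProofs.lean` and
`HomotopySpheresSignatureReduction.lean`), on the way to the named fact
`Literature.Topology.FourManifolds.HomotopySphere.mk_eq_mk_iff_sigmaGen_dvd_sub` (M. Kervaire,
J. Milnor, *Groups of homotopy spheres I*, Ann. of Math. 77 (1963), Thm. 7.5, pp. 529–530).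
Everything in this file is **proved**; no definition and no named fact is introduced (D-0026).

`HomotopySpheresSignatureReduction.lean` reduces Thm. 7.5 to Smale's h-cobordism theorem,
§2-additivity of `σ`, Kosinski's X.2.2 (all three named facts of the tree) and one hypothesis
`h34`, the middle-dimensional half of Kervaire–Milnor's Lemma 7.3: *a homotopy `(4m-1)`-sphere
bounding a compact, simply connected, s-parallelizable `M` with `Hᵢ(M; ℤ) = 0` for `0 < i < 2m`
and `σ(M) = 0` bounds a contractible manifold.* The printed proof of that half (pp. 528–529)
ends with two sentences which are pure algebraic topology: "Thus Lemma 7.1 implies that `H_kM`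
can be killed" is followed, through Thm. 6.6 (p. 526: "By a sequence of framed modifications,
`M` can be reduced to a `k`-connected manifold `M₁`. … If `bM` is a homology sphere, then `M₁`
is contractible") and p. 514 ("It will then follow from the Poincaré duality theorem that `M₁`
is contractible"), by the contractibility of the surgered manifold. This file PROVES that
step and splits `h34` accordingly.

* `NullCobordism.contractibleSpace_of_isZero_singularHomology_le` — **Thm. 6.6, last clause**
  (Kervaire–Milnor p. 526 with p. 514; Kosinski, *Differential Manifolds* (1993), p. 205: "If
  `∂M' (= ∂M)` is a homotopy sphere and `M'` is `2n`-connected, `n > 1`, then `M'` is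
  [contractible]"): let `Σ` be a homotopy `n`-sphere, `n ≥ 2`, and `W = c.W` a null-cobordism
  of `Σ` (compact, `Σ = ∂W`) which is simply connected with `H_i(W; ℤ) = 0` for `0 < i ≤ k`,
  where `n ≤ 2k`. Then `W` is contractible. Proof, as indicated on p. 514, by Poincaré
  (–Lefschetz) duality, every ingredient being a theorem of the tree: `W` simply connected is
  `ℤ`-oriented (`exists_isRelFundamentalClass_of_simplyConnectedSpace`, Hatcher Prop. 3.25 with
  p. 253); universal coefficients give `Hᵖ(W; ℤ) = 0` for `1 ≤ p ≤ k`
  (`kroneckerPairing_bijective_of_free/isZero`, Hatcher Thm. 3.2); Lefschetz duality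
  (`bijective_relCapProduct_of_isRelFundamentalClass_holds`, Spanier 6.3.12 / Hatcher 3.43)
  gives `H_q(W, ∂W; ℤ) = 0` for `n + 1 - k ≤ q ≤ n`; the exact sequence of the pair with
  `H_q(∂W) = H_q(Σ) = H_q(Sⁿ) = 0` (`0 < q < n`) gives `H_q(W) = 0` for `q < n`; in degree `n`
  the boundary of a relative fundamental class is `± incl_* [Σ]`
  (`NullCobordism.exists_isRelFundamentalClass_δ_eq`, Spanier Cor. 6.3.10), which generates
  `H_n(Σ) ≅ ℤ` (Hatcher Thm. 3.26), so `H_n(∂W) → H_n(W)` vanishes and `H_n(W) = 0`; in degrees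
  `≥ n + 1`, `W` is homotopy equivalent to itself with an external collar attached
  (`homotopyEquivExtCollar`), a connected non-compact `(n+1)`-manifold without boundary, whose
  homology vanishes there (Hatcher Prop. 3.29, `isZero_singularHomology_of_noncompact`). So
  `H̃_*(W; ℤ) = 0`, all homotopy groups vanish (Hurewicz, `hurewicz_subsingleton_holds`), `W`
  has the homotopy type of a CW complex (Hatcher Cor. A.12,
  `exists_cwComplex_homotopyEquiv_of_compactSpace_boundary_holds`) and Whitehead's theorem
  (`whitehead_contractibleSpace_holds`) makes it contractible.
* `HomotopySphere.boundsContractible_of_isZero_singularHomology_le` — hence `Σ` bounds a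
  contractible manifold (`BoundsContractible n Σ`).
* `HomotopySphere.lemma73_of_killMiddleHomology` — the hypothesis `h34` of
  `HomotopySpheresSignatureReduction.lean` (Lemma 7.3 for `(2m-1)`-connected `M`, concluding
  that `bM` bounds a contractible manifold) follows from the **surgical content of Lemma 7.3
  alone** (`hkill`): *for such `M` with `σ(M) = 0`, `H₂ₘM` can be killed* — there is a
  null-cobordism `M₁` of the same `Σ` which is simply connected with `Hᵢ(M₁; ℤ) = 0` for
  `0 < i ≤ 2m` (Kervaire–Milnor p. 529: "Thus `M` satisfies the hypothesis of 7.1. It follows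
  that `H_kM` can be killed by spherical modifications"; Thm. 6.6: "`M` can be reduced to a
  `k`-connected manifold `M₁`", `bM₁ = bM`, p. 514; Kosinski X.3.4: "There is a framed cobordism
  between `M` and a `2n`-connected manifold `M'` if and only if `σ(M) = 0`").
* `HomotopySphere.mk_eq_mk_iff_sigmaGen_dvd_sub_of_killMiddleHomology` — **Thm. 7.5 in the
  binder shape of the named fact** from (`hkill`) that surgical statement for all
  `n + 1 = 4m`, `m > 1`, (`hconn`) Kosinski X.2.2 (`exists_highlyConnected_of_mem_signatureSet`),
  (`hcob`) Smale's theorem (`nonempty_diffeomorph_of_isHCobordant_of_five_le`) and (`hadd`)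
  §2-additivity (`add_mem_signatureSet_of_isOrientedConnectedSum`). What now separates the tree
  from `mk_eq_mk_iff_sigmaGen_dvd_sub_holds` is exactly: framed surgery below (X.2.2) and in
  (X.3.4 / Lemma 7.3) the middle dimension, the h-cobordism theorem, and §2-additivity.

* `exists_commGroup_homotopySphereClass_isCyclic_seven_of_killMiddleHomology` — the summit-cone
  target next to this fact (`Θ₇` cyclic under connected sum) over the same frontier at `n = 7`
  (`hkill` at `m = 2`, `hconn`, `hcob`, `hadd`, Lemma 3.4 "⇒", `Θ₇ = bP₈`), through
  `exists_commGroup_homotopySphereClass_isCyclic_seven_of_boundsContractible`.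

Also recorded: `ExtCollar.noncompactSpace_of_nonempty_boundary` (the external collar
`W ∪ ∂W × (-∞, 0]` of a manifold with non-empty boundary is not compact: the height is unbounded
below).

## References

* M. Kervaire, J. Milnor, *Groups of homotopy spheres I*, Ann. of Math. 77 (1963), 504–537:
  p. 514 ("It will then follow from the Poincaré duality theorem that `M₁` is contractible");
  Thm. 6.6 (p. 526); Lemma 7.1 (p. 527), Lemma 7.3 and its proof (pp. 528–529); Thm. 7.5
  (pp. 529–530). doi:10.2307/1970128 [KervaireMilnorAnnals1963]
* A. Kosinski, *Differential Manifolds*, Academic Press (1993), Ch. X, Thm. (2.2), Thm. (3.4),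
  Cor. (3.6) and p. 205. [Kosinski1993]
* A. Hatcher, *Algebraic Topology*, CUP (2002), Thm. 3.2, Prop. 3.25, Thm. 3.26, Prop. 3.29,
  Thm. 3.43, Thm. 4.5, Thm. 4.32, Cor. A.12. [HatcherAT2002]
* E. Spanier, *Algebraic Topology* (1966), Ch. 6 §3, Cor. 10, Thm. 12. [Spanier1981]
-/

noncomputable section

open scoped Manifold ContDiff Topology
open Set Function CategoryTheory CategoryTheory.Limits
open Literature.AlgebraicTopology.SingularHomology Literature.AlgebraicTopology.Homotopy

universe u

namespace Literature.Topology.FourManifolds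

/-! ### The external collar of a manifold with non-empty boundary is not compact -/

/-- The external collar `W ∪ ∂W × (-∞, 0]` (`ExtCollar n W`, Hatcher 2002, proof of Prop. 3.42)
of a space `W` charted on the half-space with **non-empty** boundary is not compact: over a
boundary point `b` the collar points `(b, t)`, `t ≤ 0`, have height `t`, unbounded below, whereas
the continuous height attains a minimum on a compact space. [cite: HatcherAT2002, §3.3 proof of Prop. 3.42 (p. 253)] -/
theorem ExtCollar.noncompactSpace_of_nonempty_boundary {n : ℕ} {W : Type u} [TopologicalSpace W]
    [ChartedSpace (EuclideanHalfSpace (n + 1)) W] (h : ((𝓡∂ (n + 1)).boundary W).Nonempty) :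
    NoncompactSpace (ExtCollar n W) := by
  refine ⟨fun hc => ?_⟩
  obtain ⟨b, hb⟩ := h
  obtain ⟨x₀, -, hx₀⟩ := hc.exists_isMinOn ⟨ExtCollar.collar n (⟨b, hb⟩, 0), mem_univ _⟩
    ExtCollar.continuous_height.continuousOn
  have hle : ExtCollar.height x₀ ≤
      ExtCollar.height (ExtCollar.collar n (⟨b, hb⟩, ExtCollar.height x₀ - 1)) :=
    hx₀ (mem_univ (ExtCollar.collar n (⟨b, hb⟩, ExtCollar.height x₀ - 1)))
  rw [ExtCollar.height_collar] at hle
  have hmin : min (ExtCollar.height x₀ - 1) 0 ≤ ExtCollar.height x₀ - 1 := min_le_left _ _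
  linarith

namespace NullCobordism

/-! ### Theorem 6.6, last clause: contractibility from connectivity up to half the dimension -/

/-- **Kervaire–Milnor 1963, Thm. 6.6, last clause** ("If `bM` is a homology sphere, then `M₁` is
contractible", p. 526, of the `k`-connected `M₁` obtained by surgery; p. 514: "It will then follow
from the Poincaré duality theorem that `M₁` is contractible"; Kosinski 1993, p. 205), in the
tree's language and PROVED: let `Σ` be a homotopy `n`-sphere, `n ≥ 2`, and `c` a null-cobordism
of `Σ` (`W = c.W` compact with `∂W = Σ`) whose total space is simply connected with
`Hᵢ(W; ℤ) = 0` for `0 < i ≤ k`, where `n ≤ 2k` (i.e. `W` is `k`-connected, `k` at least half of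
`dim W - 1`). Then `W` is contractible. Proof: `Hᵖ(W; ℤ) = 0` for `1 ≤ p ≤ k` (universal
coefficients); `W` is `ℤ`-oriented (simply connected), so Lefschetz duality gives
`H_q(W, ∂W) ≅ Hⁿ⁺¹⁻q(W) = 0` for `n + 1 - k ≤ q ≤ n`; the exact sequence of the pair `(W, ∂W)` with
`H_q(∂W) = H_q(Sⁿ)` kills `H_q(W)` for `k < q < n`; in degree `n` the boundary of a relative
fundamental class is `± [Σ]`, a generator of `H_n(∂W) ≅ ℤ`, so `H_n(∂W) → H_n(W)` is zero and
`H_n(W) ↪ H_n(W, ∂W) = 0`; in degrees `≥ n + 1` the homology of `W ≃ W ∪ collar`, a connected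
non-compact `(n+1)`-manifold, vanishes (Hatcher Prop. 3.29). Hence `H̃_*(W; ℤ) = 0`, all homotopy
groups vanish (Hurewicz), and `W`, of the homotopy type of a CW complex, is contractible
(Whitehead). [cite: KervaireMilnorAnnals1963, Thm. 6.6 (p. 526, last clause) and p. 514] [cite: Kosinski1993, Ch. X, p. 205] [cite: HatcherAT2002, Thm. 3.2, Prop. 3.25, Thm. 3.26, Prop. 3.29, Thm. 3.43, Thm. 4.32, Thm. 4.5, Cor. A.12] -/
theorem contractibleSpace_of_isZero_singularHomology_le {n : ℕ} (hn : 2 ≤ n) {k : ℕ}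
    (hnk : n ≤ 2 * k) (S : HomotopySphere n) (c : NullCobordism n S.carrier)
    [SimplyConnectedSpace c.W]
    (hH : ∀ i : ℕ, 0 < i → i ≤ k → IsZero (singularHomology ℤ ℤ c.W i)) :
    ContractibleSpace c.W := by
  -- write `n = m + 1`
  obtain ⟨m, rfl⟩ : ∃ m, n = m + 1 := ⟨n - 1, by omega⟩
  haveI : PathConnectedSpace S.carrier := HomotopySphere.pathConnectedSpace (by omega) S
  haveI : ConnectedSpace S.carrier := HomotopySphere.connectedSpace (by omega) S
  haveI : SimplyConnectedSpace S.carrier := HomotopySphere.simplyConnectedSpace hn S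
  obtain ⟨x⟩ := (inferInstance : Nonempty S.carrier)
  -- (1) the homology of the boundary `∂W ≅ Σ ≃ 𝕊ⁿ` vanishes in degrees `≠ 0, n`
  have hA : ∀ q : ℕ, q ≠ 0 → q ≠ m + 1 →
      IsZero (singularHomology ℤ ℤ ↥((𝓡∂ (m + 1 + 1)).boundary c.W) q) := fun q h0 hq =>
    ((isZero_singularHomology_sphere_holds ℤ ℤ h0 hq).of_iso
      (singularHomology.isoOfHomotopyEquiv ℤ ℤ (Classical.choice S.nonempty_homotopyEquiv) q)).of_iso
      (singularHomology.mapIso ℤ ℤ c.bdryHomeomorph q).symm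
  -- (2) a relative fundamental class whose boundary is `incl_* [Σ]_μ`
  obtain ⟨μ⟩ : IsOrientableOver ℤ S.carrier (m + 1) :=
    isOrientableOver_of_simplyConnectedSpace ℤ S.carrier
  obtain ⟨z₀, hz₀⟩ := exists_isRelFundamentalClass_of_simplyConnectedSpace (m + 1) c.W
  obtain ⟨z, hz, hδz⟩ := c.exists_isRelFundamentalClass_δ_eq μ hz₀
  -- (3) `Hᵖ(W; ℤ) = 0` for `1 ≤ p ≤ k` (universal coefficients)
  have hcoh : ∀ p : ℕ, 1 ≤ p → p ≤ k → IsZero (singularCohomology ℤ ℤ c.W p) := by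
    intro p hp hpk
    obtain ⟨p', rfl⟩ : ∃ p', p = p' + 1 := ⟨p - 1, by omega⟩
    have hbij : Bijective (kroneckerPairing ℤ ℤ c.W (p' + 1)) := by
      rcases Nat.eq_zero_or_pos p' with rfl | hpos
      · haveI : Module.Free ℤ (singularHomology ℤ ℤ c.W 0) := free_singularHomology_zero
        exact kroneckerPairing_bijective_of_free ℤ c.W 0
      · exact kroneckerPairing_bijective_of_isZero ℤ c.W p' (hH p' hpos (by omega))
    haveI : Subsingleton (singularHomology ℤ ℤ c.W (p' + 1)) :=
      ModuleCat.subsingleton_of_isZero (hH (p' + 1) (by omega) hpk)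
    haveI : Subsingleton (singularCohomology ℤ ℤ c.W (p' + 1)) := hbij.1.subsingleton
    exact ModuleCat.isZero_of_subsingleton _
  -- (4) Lefschetz duality: `H_q(W, ∂W; ℤ) ≅ Hⁿ⁺¹⁻q(W; ℤ) = 0` for `n + 1 - k ≤ q ≤ n`
  have hrel : ∀ q : ℕ, m + 2 ≤ q + k → q ≤ m + 1 →
      IsZero (relativeSingularHomology ℤ ℤ c.W ((𝓡∂ (m + 1 + 1)).boundary c.W) q) := by
    intro q hqk hq
    have hb := bijective_relCapProduct_of_isRelFundamentalClass_holds (R := ℤ) (m + 1) c.W z hz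
      (p := m + 2 - q) (q := q) (by omega)
    haveI : Subsingleton (singularCohomology ℤ ℤ c.W (m + 2 - q)) :=
      ModuleCat.subsingleton_of_isZero (hcoh _ (by omega) (by omega))
    haveI : Subsingleton (relativeSingularHomology ℤ ℤ c.W ((𝓡∂ (m + 1 + 1)).boundary c.W) q) :=
      hb.surjective.subsingleton
    exact ModuleCat.isZero_of_subsingleton _
  -- (5) `H_q(W) = 0` for `1 ≤ q < n`: the hypothesis for `q ≤ k`, else the pair sequence
  have hlow : ∀ q : ℕ, 1 ≤ q → q ≤ m → IsZero (singularHomology ℤ ℤ c.W q) := by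
    intro q h1 hqm
    by_cases hqk : q ≤ k
    · exact hH q h1 hqk
    · exact (relativeSingularHomology.exact_map_ofAbsolute ℤ ℤ ((𝓡∂ (m + 1 + 1)).boundary c.W)
          q).isZero_of_both_zeros ((hA q (by omega) (by omega)).eq_of_src _ _)
        ((hrel q (by omega) (by omega)).eq_of_tgt _ _)
  -- (6) degree `n`: `H_n(∂W) ≅ H_n(Σ) ≅ ℤ` is generated by `∂ z = incl_* [Σ]_μ`, killed in `H_n(W)`
  have hee : (c.bdryHomeomorph : C(S.carrier, ↥((𝓡∂ (m + 1 + 1)).boundary c.W))) =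
      boundaryCorestrict (m + 1) c.inclMap c.incl_mem_boundary := by
    ext y : 2
    rfl
  have h0 : singularHomology.map ℤ ℤ
      (⟨Subtype.val, continuous_subtype_val⟩ : C(↥((𝓡∂ (m + 1 + 1)).boundary c.W), c.W)) (m + 1)
      (relativeSingularHomology.δ ℤ ℤ c.W ((𝓡∂ (m + 1 + 1)).boundary c.W) (m + 1) z) = 0 := by
    rw [← ModuleCat.comp_apply, relativeSingularHomology.δ_comp_map]
    rfl
  have hi : singularHomology.map ℤ ℤ
      (⟨Subtype.val, continuous_subtype_val⟩ : C(↥((𝓡∂ (m + 1 + 1)).boundary c.W), c.W))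
      (m + 1) = 0 := by
    haveI : Epi (singularHomology.map ℤ ℤ (boundaryCorestrict (m + 1) c.inclMap c.incl_mem_boundary)
        (m + 1)) := by
      rw [← hee, ← singularHomology.mapIso_hom]
      infer_instance
    refine (cancel_epi (singularHomology.map ℤ ℤ
      (boundaryCorestrict (m + 1) c.inclMap c.incl_mem_boundary) (m + 1))).1 ?_
    rw [comp_zero]
    -- `H_n(Σ) ≅ H_n(Σ | x) ≅ ℤ`, `[Σ]_μ ↦ 1` (Hatcher Thm. 3.26)
    haveI := singularHomology.isIso_toLocal_of_orientation μ x
    obtain ⟨e, he⟩ := μ.isGenerator x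
    have hfc : singularHomology.toLocal ℤ ℤ x (m + 1) μ.fundamentalClass = μ.localClass x :=
      HomologicalOrientation.isFundamentalClass_fundamentalClass_holds (R := ℤ) (X := S.carrier)
        (m + 1) μ x
    let φ : singularHomology ℤ ℤ S.carrier (m + 1) ≃ₗ[ℤ] ℤ :=
      (asIso (singularHomology.toLocal ℤ ℤ x (m + 1))).toLinearEquiv.trans e
    have hφ : φ.symm 1 = μ.fundamentalClass := by
      rw [LinearEquiv.symm_apply_eq]
      change 1 = e ((asIso (singularHomology.toLocal ℤ ℤ x (m + 1))).hom μ.fundamentalClass)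
      rw [asIso_hom, hfc, he]
    -- the composite `H_n(Σ) → H_n(∂W) → H_n(W)` vanishes on `[Σ]_μ`, hence on `ℤ · [Σ]_μ = H_n(Σ)`
    have h1 : (singularHomology.map ℤ ℤ (boundaryCorestrict (m + 1) c.inclMap c.incl_mem_boundary)
        (m + 1) ≫ singularHomology.map ℤ ℤ
          (⟨Subtype.val, continuous_subtype_val⟩ : C(↥((𝓡∂ (m + 1 + 1)).boundary c.W), c.W))
          (m + 1)) μ.fundamentalClass = 0 := by
      rw [ModuleCat.comp_apply, ← hδz, h0]
    have key : (singularHomology.map ℤ ℤ (boundaryCorestrict (m + 1) c.inclMap c.incl_mem_boundary)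
        (m + 1) ≫ singularHomology.map ℤ ℤ
          (⟨Subtype.val, continuous_subtype_val⟩ : C(↥((𝓡∂ (m + 1 + 1)).boundary c.W), c.W))
          (m + 1)).hom ∘ₗ φ.symm.toLinearMap = 0 := by
      refine LinearMap.ext_ring ?_
      rw [LinearMap.zero_apply, LinearMap.comp_apply, LinearEquiv.coe_coe, hφ]
      exact h1
    ext a
    have hka := LinearMap.congr_fun key (φ a)
    rw [LinearMap.comp_apply, LinearEquiv.coe_coe, LinearEquiv.symm_apply_apply,
      LinearMap.zero_apply] at hka
    rw [ModuleCat.hom_zero, LinearMap.zero_apply]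
    exact hka
  have htop : IsZero (singularHomology ℤ ℤ c.W (m + 1)) :=
    (relativeSingularHomology.exact_map_ofAbsolute ℤ ℤ ((𝓡∂ (m + 1 + 1)).boundary c.W)
        (m + 1)).isZero_of_both_zeros hi ((hrel (m + 1) (by omega) le_rfl).eq_of_tgt _ _)
  -- (7) degrees `≥ n + 1`: `W ≃ W ∪ collar`, a connected non-compact `(n+1)`-manifold
  have hhigh : ∀ q : ℕ, m + 1 + 1 ≤ q → IsZero (singularHomology ℤ ℤ c.W q) := by
    intro q hq
    haveI : SimplyConnectedSpace (ExtCollar (m + 1) c.W) :=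
      (homotopyEquivExtCollar (m + 1) c.W).symm.simplyConnectedSpace
    haveI : NoncompactSpace (ExtCollar (m + 1) c.W) :=
      ExtCollar.noncompactSpace_of_nonempty_boundary ⟨c.incl x, c.incl_mem_boundary x⟩
    exact (clocalHomology.isZero_singularHomology_of_noncompact ℤ ℤ
      (X := ExtCollar (m + 1) c.W) (n := m + 1 + 1) hq).of_iso
      (singularHomology.isoOfHomotopyEquiv ℤ ℤ (homotopyEquivExtCollar (m + 1) c.W) q)
  -- (8) `H̃_*(W; ℤ) = 0`; Hurewicz, CW type, Whitehead
  have hac : ∀ q : ℕ, 1 ≤ q → IsZero (singularHomology ℤ ℤ c.W q) := by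
    intro q hq
    rcases lt_trichotomy q (m + 1) with h | rfl | h
    · exact hlow q hq (by omega)
    · exact htop
    · exact hhigh q (by omega)
  have hπ := subsingleton_homotopyGroup_of_isZero_singularHomology_of_subsingleton
    hurewicz_subsingleton_holds hac
  obtain ⟨C, _, _, _, ⟨e⟩⟩ :=
    exists_cwComplex_homotopyEquiv_of_compactSpace_boundary_holds (m + 1) c.W
  haveI : SimplyConnectedSpace C := e.symm.simplyConnectedSpace
  have hC : ∀ j : ℕ, 1 ≤ j → ∀ y : C, Subsingleton (π_ j C y) := fun j hj y =>
    subsingleton_homotopyGroup_of_homotopyEquiv e.symm (hπ j hj) y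
  haveI : ContractibleSpace C := whitehead_contractibleSpace_holds C hC
  exact e.contractibleSpace

end NullCobordism

namespace HomotopySphere

variable {n : ℕ}

/-- **A homotopy sphere bounding a compact simply connected `W` with `Hᵢ(W; ℤ) = 0` for
`0 < i ≤ k`, `dim W - 1 = n ≤ 2k`, `n ≥ 2`, bounds a contractible manifold** — namely `W`
itself (`NullCobordism.contractibleSpace_of_isZero_singularHomology_le`; Kervaire–Milnor 1963,
Thm. 6.6, last clause, with p. 514). [cite: KervaireMilnorAnnals1963, Thm. 6.6 (p. 526, last clause) and p. 514] -/
theorem boundsContractible_of_isZero_singularHomology_le (hn : 2 ≤ n) {k : ℕ} (hnk : n ≤ 2 * k)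
    (S : HomotopySphere n) (c : NullCobordism n S.carrier) [SimplyConnectedSpace c.W]
    (hH : ∀ i : ℕ, 0 < i → i ≤ k → IsZero (singularHomology ℤ ℤ c.W i)) :
    BoundsContractible n S.carrier := by
  haveI := NullCobordism.contractibleSpace_of_isZero_singularHomology_le hn hnk S c hH
  exact c.boundsContractible

/-! ### Lemma 7.3 for highly connected `M` from its surgical content: "`H₂ₘM` can be killed" -/

/-- **The middle-dimensional half of Lemma 7.3, in the form `h34` of
`HomotopySpheresSignatureReduction.lean`, from its surgical content.** For `n + 1 = 4m`, `m > 1`: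
GIVEN (`hkill`) that for every homotopy `n`-sphere `Σ = bM` with `M = c.W` compact, simply
connected, `Hᵢ(M; ℤ) = 0` for `0 < i < 2m`, s-parallelizable and of signature `σ(M) = 0` (for
some homological orientation of `M ∪ cone(bM)`), **`H₂ₘM` can be killed** — there is a
null-cobordism `M₁` of the same `Σ` which is simply connected with `Hᵢ(M₁; ℤ) = 0` for
`0 < i ≤ 2m` (Kervaire–Milnor 1963, proof of Lemma 7.3, p. 529: "Thus `M` satisfies the
hypothesis of 7.1. It follows that `H_kM` can be killed by spherical modifications", with
Thm. 6.6, p. 526: "`M` can be reduced to a `k`-connected manifold `M₁`", and `bM₁ = bM`, p. 514;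
Kosinski 1993, X.3.4) — every such `Σ` bounds a contractible manifold, since `M₁` is contractible
(`NullCobordism.contractibleSpace_of_isZero_singularHomology_le`, Thm. 6.6, last clause).
[cite: KervaireMilnorAnnals1963, Lemma 7.3, proof p. 529, with Thm. 6.6 (p. 526) and p. 514] [cite: Kosinski1993, Ch. X, Thm. (3.4) and p. 205] -/
theorem lemma73_of_killMiddleHomology {m : ℕ} {h : n + 1 = 4 * m} (hm : 1 < m)
    (hkill : ∀ (S : HomotopySphere n) (c : NullCobordism n S.carrier)
      (μ' : HomologicalOrientation ℤ (ClosedModel n c.W) (n + 1)),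
      SimplyConnectedSpace c.W →
      (∀ i : ℕ, 0 < i → i < 2 * m → Subsingleton (singularHomology ℤ ℤ c.W i)) →
      IsStablyParallelizable (𝓡∂ (n + 1)) c.W →
        μ'.signatureInDim (show 2 * m + 2 * m = n + 1 by omega) = 0 →
          ∃ c₁ : NullCobordism n S.carrier, SimplyConnectedSpace c₁.W ∧
            ∀ i : ℕ, 0 < i → i ≤ 2 * m → Subsingleton (singularHomology ℤ ℤ c₁.W i)) :
    ∀ (S : HomotopySphere n) (c : NullCobordism n S.carrier)
      (μ' : HomologicalOrientation ℤ (ClosedModel n c.W) (n + 1)),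
      SimplyConnectedSpace c.W →
      (∀ i : ℕ, 0 < i → i < 2 * m → Subsingleton (singularHomology ℤ ℤ c.W i)) →
      IsStablyParallelizable (𝓡∂ (n + 1)) c.W →
        μ'.signatureInDim (show 2 * m + 2 * m = n + 1 by omega) = 0 →
          BoundsContractible n S.carrier := by
  intro S c μ' hsc hH hpar hsig
  obtain ⟨c₁, hsc₁, hH₁⟩ := hkill S c μ' hsc hH hpar hsig
  haveI := hsc₁
  exact boundsContractible_of_isZero_singularHomology_le (k := 2 * m) (by omega) (by omega) S c₁
    fun i hi hik => by
      haveI := hH₁ i hi hik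
      exact ModuleCat.isZero_of_subsingleton _

/-- **Kervaire–Milnor Thm. 7.5 from "`H₂ₘM` can be killed", Kosinski's X.2.2, Smale's
h-cobordism theorem and §2-additivity.** The named fact `mk_eq_mk_iff_sigmaGen_dvd_sub` (Thm. 7.5,
pp. 529–530) GIVEN: (`hkill`) for all `n + 1 = 4m`, `m > 1`, the surgical content of Lemma 7.3
for `(2m-1)`-connected `M` — a homotopy `n`-sphere `Σ = bM`, `M` compact, simply connected,
`Hᵢ(M; ℤ) = 0` for `0 < i < 2m`, s-parallelizable, `σ(M) = 0`, also bounds a simply connected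
`M₁` with `Hᵢ(M₁; ℤ) = 0` for `0 < i ≤ 2m` (Kervaire–Milnor pp. 528–529 with Lemma 7.1, Lemma 6.2
and Thm. 6.6; Kosinski X.3.4; framed surgery in the middle dimension, not in the tree);
(`hconn`) the named fact `exists_highlyConnected_of_mem_signatureSet` (Kosinski X.2.2 with X.3.3;
Kervaire–Milnor Thm. 5.5); (`hcob`) the named fact `nonempty_diffeomorph_of_isHCobordant_of_five_le`
(Smale); (`hadd`) the named fact `add_mem_signatureSet_of_isOrientedConnectedSum` (§2). Assembly:
`mk_eq_mk_iff_sigmaGen_dvd_sub_of_highlyConnected` with `lemma73_of_killMiddleHomology`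
(Thm. 6.6, last clause, proved here). [cite: KervaireMilnorAnnals1963, Thm. 7.5 (pp. 529–530), with Lemma 7.3 (pp. 528–529), Thm. 5.5 (p. 514), Thm. 6.6 (p. 526)] [cite: Kosinski1993, Ch. X, Thm. (2.2), Thm. (3.4), Cor. (3.6)] [cite: MilnorHCobordism1965, Thm. 9.1] -/
theorem mk_eq_mk_iff_sigmaGen_dvd_sub_of_killMiddleHomology
    (hkill : ∀ (n m : ℕ) (h : n + 1 = 4 * m), 1 < m →
      ∀ (S : HomotopySphere n) (c : NullCobordism n S.carrier)
        (μ' : HomologicalOrientation ℤ (ClosedModel n c.W) (n + 1)),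
        SimplyConnectedSpace c.W →
        (∀ i : ℕ, 0 < i → i < 2 * m → Subsingleton (singularHomology ℤ ℤ c.W i)) →
        IsStablyParallelizable (𝓡∂ (n + 1)) c.W →
          μ'.signatureInDim (show 2 * m + 2 * m = n + 1 by omega) = 0 →
            ∃ c₁ : NullCobordism n S.carrier, SimplyConnectedSpace c₁.W ∧
              ∀ i : ℕ, 0 < i → i ≤ 2 * m → Subsingleton (singularHomology ℤ ℤ c₁.W i))
    (hconn : exists_highlyConnected_of_mem_signatureSet)
    (hcob : FourManifolds.nonempty_diffeomorph_of_isHCobordant_of_five_le.{0})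
    (hadd : add_mem_signatureSet_of_isOrientedConnectedSum) :
    mk_eq_mk_iff_sigmaGen_dvd_sub :=
  mk_eq_mk_iff_sigmaGen_dvd_sub_of_highlyConnected
    (fun n m h hm => lemma73_of_killMiddleHomology (h := h) hm (hkill n m h hm)) hconn hcob hadd

end HomotopySphere

/-! ### The cone target `Θ₇` cyclic, over the resulting frontier -/

/-- **`Θ₇` is a cyclic group under connected sum, from "`H₄M` can be killed" at `n = 7`,
Kosinski's X.2.2, Smale's h-cobordism theorem, §2-additivity, Lemma 3.4 "⇒" and `Θ₇ = bP₈`.** The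
target `Literature.Topology.FourManifolds.exists_commGroup_homotopySphereClass_isCyclic_seven`
GIVEN: (`hkill`) the surgical content of Kervaire–Milnor's Lemma 7.3 at `n = 7`, `m = 2` — a
homotopy `7`-sphere `Σ = bM` with `M` compact, simply connected, `Hᵢ(M; ℤ) = 0` for `0 < i < 4`,
s-parallelizable and `σ(M) = 0` also bounds a simply connected `M₁` with `Hᵢ(M₁; ℤ) = 0` for
`0 < i ≤ 4` (pp. 528–529 with Thm. 6.6; Kosinski X.3.4); (`hconn`) the named fact
`HomotopySphere.exists_highlyConnected_of_mem_signatureSet` (Kosinski X.2.2); (`hcob`) the named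
fact `nonempty_diffeomorph_of_isHCobordant_of_five_le` (Smale); (`hadd`) §2-additivity
(`HomotopySphere.add_mem_signatureSet_of_isOrientedConnectedSum`); (`hne`) Lemma 3.4 "⇒"
(`HomotopySphere.nonempty_signatureSet_of_boundsParallelizable`); (`hB`) `Θ₇ = bP₈`
(`HomotopySphere.boundsParallelizable_seven`). Assembly:
`exists_commGroup_homotopySphereClass_isCyclic_seven_of_boundsContractible`
(`HomotopySpheresSignatureReduction.lean`) with Lemma 7.3 at `n = 7` supplied by
`HomotopySphere.lemma73_of_killMiddleHomology` (Thm. 6.6, last clause, proved above) and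
`HomotopySphere.boundsContractible_of_zero_mem_signatureSet_of_highlyConnected`.
[cite: KervaireMilnorAnnals1963, Cor. 7.6 (p. 530, first sentence) at m = 2, with Thm. 7.5, Lemma 7.3 (pp. 528–529), Thm. 6.6 (p. 526), §4 table p. 512] [cite: Kosinski1993, Ch. X, Thm. (2.2), Thm. (3.4)] -/
theorem exists_commGroup_homotopySphereClass_isCyclic_seven_of_killMiddleHomology
    (hkill : ∀ (S : HomotopySphere 7) (c : NullCobordism 7 S.carrier)
      (μ' : HomologicalOrientation ℤ (ClosedModel 7 c.W) (7 + 1)),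
      SimplyConnectedSpace c.W →
      (∀ i : ℕ, 0 < i → i < 2 * 2 → Subsingleton (singularHomology ℤ ℤ c.W i)) →
      IsStablyParallelizable (𝓡∂ (7 + 1)) c.W →
        μ'.signatureInDim (show 2 * 2 + 2 * 2 = 7 + 1 by norm_num) = 0 →
          ∃ c₁ : NullCobordism 7 S.carrier, SimplyConnectedSpace c₁.W ∧
            ∀ i : ℕ, 0 < i → i ≤ 2 * 2 → Subsingleton (singularHomology ℤ ℤ c₁.W i))
    (hconn : HomotopySphere.exists_highlyConnected_of_mem_signatureSet)
    (hcob : FourManifolds.nonempty_diffeomorph_of_isHCobordant_of_five_le.{0})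
    (hadd : HomotopySphere.add_mem_signatureSet_of_isOrientedConnectedSum)
    (hne : HomotopySphere.nonempty_signatureSet_of_boundsParallelizable)
    (hB : HomotopySphere.boundsParallelizable_seven) :
    exists_commGroup_homotopySphereClass_isCyclic_seven :=
  exists_commGroup_homotopySphereClass_isCyclic_seven_of_boundsContractible
    (fun _ h S h0 =>
      HomotopySphere.boundsContractible_of_zero_mem_signatureSet_of_highlyConnected (h := h)
        (by norm_num) (HomotopySphere.lemma73_of_killMiddleHomology (h := h) (by norm_num) hkill)
        hconn S h0)
    hcob hadd hne hB

end Literature.Topology.FourManifolds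

end
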